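import Literature.NumberTheory.LFunctions.NotAlmostMonomialGL23Characters
import HarnessLib

/-!
# Booker's counterexample `GL₂(𝔽₃)`, II: `χ₄ − χ₂` is DM-positive; `GL(2,3)` is not almost monomial

Topic `Literature/NumberTheory/LFunctions`; namespace `Literature.NumberTheory.LFunctions`, grouping
namespace `Booker2006.GL23`.  Completes the discharge of the `GL₂(𝔽₃)` clause of the named fact
`booker2006_notAlmostMonomial` (`CertifiedArtinHolomorphyCriterion.lean`; Booker, Exp. Math. 15
(2006) §2 p. 390: "one might hope that all groups are almost monomial. That is not the case, as the
counterexamples `GL₂(𝔽₃)` and `SL₂(𝔽₅)` show"; a GAP computation, no vector printed for `GL₂(𝔽₃)`):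
**`Booker2006.not_isAlmostMonomial_GL23 : ¬ IsAlmostMonomial (GL (Fin 2) (ZMod 3))`.**

With `χ₄` (principal series, degree 4), `χ₂` (faithful, degree 2) and `χ₁ = χ₄ − χ₂` from
`NotAlmostMonomialGL23Characters.lean`, the content is **`IsDMPositive χ₁`**: for every subgroup `H`
and every linear character `λ` of `H`, `⟨χ₁, Ind_H λ⟩ = |H|⁻¹ Σ_{h∈H} χ₁(h) λ(h⁻¹) ≥ 0` (Frobenius).
By the kernel-certified subgroup table `Literature.GroupTheory.GL23.exists_conj`, `H = y K y⁻¹` for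
one of sixteen listed `K`; the sum is transported to `K` (`χ₁` is a class function) with
`λ'(k) = λ(yky⁻¹)`.  Values of `χ₁` by class type `1, −1, ord 4, ord 3, ord 6, reflection, 8A, 8B`:
`2, −2, 0, 2, −2, 0, −i√2, i√2` (`i√2 = (1+i)u`, `u = e^{iπ/4}`).  Then:
* `K ∈ {Q₈, D₈, SD₁₆, SL(2,3), G}`: `−1` is a commutator inside `K`, so `λ'(−1) = 1` and
  `χ₁(−k) = −χ₁(k)` makes the sum vanish;
* `K = ⟨c⟩` cyclic of order `2, 2, 3, 4, 6, 8`: the sum is a polynomial in `u' = λ'(c⁻¹)`,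
  `u'^m = 1`, equal to a non-negative constant on the roots of each cyclotomic factor of `X^m − 1`
  (for `C₈`: `(1 − u'⁴)(2 − i√2 (u' + u'³)) ∈ {0, 8}` using `(u' + u'³)² = −2` when `u'⁴ = −1`);
* `K ∈ {V₄, S₃, S₃', D₁₂}` listed as `⟨a⟩ ++ ⟨a⟩x`: `χ₁` vanishes on the coset (reflections) and
  the `⟨a⟩`-part is the cyclic case.
Assembly: `χ₄ = χ₁ + χ₂` with `χ₁, χ₂` non-zero DM-positive virtual characters (`χ₁(1) = χ₂(1) = 2`)
contradicts Definition 2.1 for the irreducible `χ₄`.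

## References
* [Booker2006] A. R. Booker, *Artin's conjecture, Turing's method, and the Riemann hypothesis*,
  Experiment. Math. 15 (2006) 385–407, §2 Definition 2.1 (p. 389), p. 390.
* [SerreLinearRepresentations1977] J.-P. Serre, *Linear Representations of Finite Groups*, §7.2 Thm. 13.
* [HoltEickOBrien2005] D. F. Holt, B. Eick, E. A. O'Brien, *Handbook of Computational Group Theory*,
  §3.1 (the subgroup table replaced by `GL23.exists_conj`).
-/

noncomputable section

open scoped ComplexOrder MatrixGroups
open Finset Complex

namespace Literature.NumberTheory.LFunctions

namespace Booker2006

namespace GL23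

open Literature.RepresentationTheory.FiniteGroups Literature.GroupTheory Literature.GroupTheory.GL23
  Literature.GroupTheory.SubgroupCert

/-! ### Pure algebra -/

/-- `(0 : ℂ) ≤ n`. [folklore] -/
private theorem natCast_nonneg' (n : ℕ) : (0 : ℂ) ≤ (n : ℂ) := by exact_mod_cast Nat.zero_le n

/-- `2 + 0·u' ≥ 0`. [cite: Booker2006, §2 p. 390] -/
private theorem P2a_nonneg (u : ℂ) : 0 ≤ 2 + 0 * u := by
  rw [show (2 : ℂ) + 0 * u = (2 : ℕ) by push_cast; ring]; exact natCast_nonneg' _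

/-- `2 − 2u' ≥ 0` for `u'² = 1`. [cite: Booker2006, §2 p. 390] -/
private theorem P2_nonneg (u : ℂ) (hu : u ^ 2 = 1) : 0 ≤ 2 + -2 * u := by
  have hf : (u - 1) * (u + 1) = 0 := by linear_combination hu
  rcases mul_eq_zero.mp hf with h | h
  · rw [show (2 : ℂ) + -2 * u = (0 : ℕ) by push_cast; linear_combination (-2 : ℂ) * h]
    exact natCast_nonneg' _
  · rw [show (2 : ℂ) + -2 * u = (4 : ℕ) by push_cast; linear_combination (-2 : ℂ) * h]
    exact natCast_nonneg' _

/-- `2 + 2u' + 2u'² ≥ 0` for `u'³ = 1`. [cite: Booker2006, §2 p. 390] -/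
private theorem P3_nonneg (u : ℂ) (hu : u ^ 3 = 1) : 0 ≤ 2 + 2 * u + 2 * u ^ 2 := by
  have hf : (u - 1) * (u ^ 2 + u + 1) = 0 := by linear_combination hu
  rcases mul_eq_zero.mp hf with h | h
  · rw [show (2 : ℂ) + 2 * u + 2 * u ^ 2 = (6 : ℕ) by push_cast; linear_combination (4 + 2 * u) * h]
    exact natCast_nonneg' _
  · rw [show (2 : ℂ) + 2 * u + 2 * u ^ 2 = (0 : ℕ) by push_cast; linear_combination (2 : ℂ) * h]
    exact natCast_nonneg' _

/-- `2 − 2u'² ≥ 0` for `u'⁴ = 1`. [cite: Booker2006, §2 p. 390] -/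
private theorem P4_nonneg (u : ℂ) (hu : u ^ 4 = 1) : 0 ≤ 2 + 0 * u + -2 * u ^ 2 + 0 * u ^ 3 := by
  have hf : (u ^ 2 - 1) * (u ^ 2 + 1) = 0 := by linear_combination hu
  rcases mul_eq_zero.mp hf with h | h
  · rw [show (2 : ℂ) + 0 * u + -2 * u ^ 2 + 0 * u ^ 3 = (0 : ℕ) by
      push_cast; linear_combination (-2 : ℂ) * h]
    exact natCast_nonneg' _
  · rw [show (2 : ℂ) + 0 * u + -2 * u ^ 2 + 0 * u ^ 3 = (4 : ℕ) by
      push_cast; linear_combination (-2 : ℂ) * h]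
    exact natCast_nonneg' _

/-- `2 − 2u' + 2u'² − 2u'³ + 2u'⁴ − 2u'⁵ ≥ 0` for `u'⁶ = 1`. [cite: Booker2006, §2 p. 390] -/
private theorem P6_nonneg (u : ℂ) (hu : u ^ 6 = 1) :
    0 ≤ 2 + -2 * u + 2 * u ^ 2 + -2 * u ^ 3 + 2 * u ^ 4 + -2 * u ^ 5 := by
  have hf : (u - 1) * (u + 1) * (u ^ 2 + u + 1) * (u ^ 2 - u + 1) = 0 := by linear_combination hu
  rcases mul_eq_zero.mp hf with h | h
  · rcases mul_eq_zero.mp h with h | h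
    · rcases mul_eq_zero.mp h with h | h
      · rw [show (2 : ℂ) + -2 * u + 2 * u ^ 2 + -2 * u ^ 3 + 2 * u ^ 4 + -2 * u ^ 5 = (0 : ℕ) by
          push_cast; linear_combination (-2 - 2 * u ^ 2 - 2 * u ^ 4) * h]
        exact natCast_nonneg' _
      · rw [show (2 : ℂ) + -2 * u + 2 * u ^ 2 + -2 * u ^ 3 + 2 * u ^ 4 + -2 * u ^ 5 = (12 : ℕ) by
          push_cast; linear_combination (-10 + 8 * u - 6 * u ^ 2 + 4 * u ^ 3 - 2 * u ^ 4) * h]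
        exact natCast_nonneg' _
    · rw [show (2 : ℂ) + -2 * u + 2 * u ^ 2 + -2 * u ^ 3 + 2 * u ^ 4 + -2 * u ^ 5 = (0 : ℕ) by
        push_cast; linear_combination (2 - 4 * u + 4 * u ^ 2 - 2 * u ^ 3) * h]
      exact natCast_nonneg' _
  · rw [show (2 : ℂ) + -2 * u + 2 * u ^ 2 + -2 * u ^ 3 + 2 * u ^ 4 + -2 * u ^ 5 = (0 : ℕ) by
      push_cast; linear_combination (2 - 2 * u ^ 3) * h]
    exact natCast_nonneg' _

/-- The `C₈` polynomial: `2 − ρu' − ρu'³ − 2u'⁴ + ρu'⁵ + ρu'⁷ ≥ 0` for `u'⁸ = 1`, where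
`ρ = (1+i)u = i√2` (`ρ² = −2`): it equals `(1 − u'⁴)(2 − ρ(u' + u'³)) ∈ {0, 8}`.
[cite: Booker2006, §2 p. 390] -/
private theorem P8_nonneg (u : ℂ) (hu : u ^ 8 = 1) :
    0 ≤ 2 + -((1 + I) * uC) * u + 0 * u ^ 2 + -((1 + I) * uC) * u ^ 3 + -2 * u ^ 4 +
      (1 + I) * uC * u ^ 5 + 0 * u ^ 6 + (1 + I) * uC * u ^ 7 := by
  set ρ := (1 + I) * uC with hρ
  have hρ2 : ρ ^ 2 + 2 = 0 := by rw [hρ, rho_sq]; ring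
  have hf : (u ^ 4 - 1) * (u ^ 4 + 1) = 0 := by linear_combination hu
  rcases mul_eq_zero.mp hf with h | h
  · rw [show 2 + -ρ * u + 0 * u ^ 2 + -ρ * u ^ 3 + -2 * u ^ 4 + ρ * u ^ 5 + 0 * u ^ 6 + ρ * u ^ 7 =
        ((0 : ℕ) : ℂ) by push_cast; linear_combination (-2 + ρ * u + ρ * u ^ 3) * h]
    exact natCast_nonneg' _
  · have hv : (u + u ^ 3 - ρ) * (u + u ^ 3 + ρ) = 0 := by
      linear_combination (u ^ 2 + 2) * h - hρ2
    rcases mul_eq_zero.mp hv with hv | hv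
    · rw [show 2 + -ρ * u + 0 * u ^ 2 + -ρ * u ^ 3 + -2 * u ^ 4 + ρ * u ^ 5 + 0 * u ^ 6 + ρ * u ^ 7 =
          ((8 : ℕ) : ℂ) by
        push_cast; linear_combination (-2 + ρ * u + ρ * u ^ 3) * h + (-2 * ρ) * hv + (-2) * hρ2]
      exact natCast_nonneg' _
    · rw [show 2 + -ρ * u + 0 * u ^ 2 + -ρ * u ^ 3 + -2 * u ^ 4 + ρ * u ^ 5 + 0 * u ^ 6 + ρ * u ^ 7 =
          ((0 : ℕ) : ℂ) by
        push_cast; linear_combination (-2 + ρ * u + ρ * u ^ 3) * h + (-2 * ρ) * hv + 2 * hρ2]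
      exact natCast_nonneg' _

/-! ### Sums over cyclic listings -/

/-- `λ'(cʲ) = λ'(c)ʲ` for `j ≤ m` when `c⁰, …, c^{m−1} ∈ K`. [folklore] -/
private theorem theta_pow (K : List (GL (Fin 2) (ZMod 3))) (θ' : GL (Fin 2) (ZMod 3) → ℂ)
    (h1 : θ' 1 = 1) (hmul : ∀ a ∈ K, ∀ b ∈ K, θ' (a * b) = θ' a * θ' b) (c : GL (Fin 2) (ZMod 3))
    (m : ℕ) (hmem : ∀ j < m, c ^ j ∈ K) : ∀ j ≤ m, θ' (c ^ j) = θ' c ^ j := by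
  intro j hj
  induction j with
  | zero => simp [h1]
  | succ j ih =>
    by_cases hj0 : j = 0
    · subst hj0; simp
    · rw [pow_succ, hmul _ (hmem j (by omega)) _ (by simpa using hmem 1 (by omega)), ih (by omega)]
      ring

/-- **The sum over a cyclic listing** `[c⁰, …, c^{m−1}]`, `c^m = 1`: for `λ'` multiplicative with
`λ'(1) = 1`, `Σ_k χ₁(k) λ'(k⁻¹) = Σ_{j<m} χ₁(cʲ) u'ʲ` with `u' = λ'(c^{m−1})`, `u'^m = 1`.
[cite: SerreLinearRepresentations1977, §7.2] -/
private theorem cyclic_sum (c : GL (Fin 2) (ZMod 3)) (m : ℕ) (hm : 0 < m) (hcm : c ^ m = 1)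
    (hnd : ((List.range m).map (c ^ ·)).Nodup) (θ' : GL (Fin 2) (ZMod 3) → ℂ) (h1 : θ' 1 = 1)
    (hmul : ∀ a ∈ (List.range m).map (c ^ ·), ∀ b ∈ (List.range m).map (c ^ ·),
      θ' (a * b) = θ' a * θ' b) :
    (∑ k ∈ ((List.range m).map (c ^ ·)).toFinset, chi1 k * θ' k⁻¹ =
      ∑ j ∈ Finset.range m, chi1 (c ^ j) * θ' (c ^ (m - 1)) ^ j) ∧ θ' (c ^ (m - 1)) ^ m = 1 := by
  set K := (List.range m).map (c ^ ·) with hK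
  have hmod : ∀ n, c ^ n = c ^ (n % m) := fun n => by
    conv_lhs => rw [← Nat.mod_add_div n m, pow_add, pow_mul, hcm, one_pow, mul_one]
  have hmemK : ∀ n, c ^ n ∈ K := fun n => by
    rw [hmod n]
    exact List.mem_map.mpr ⟨n % m, List.mem_range.mpr (Nat.mod_lt _ hm), rfl⟩
  set d := c ^ (m - 1) with hd
  have hdpow : ∀ i, d ^ i ∈ K := fun i => by rw [hd, ← pow_mul]; exact hmemK _
  have hθd : ∀ i ≤ m, θ' (d ^ i) = θ' d ^ i :=
    theta_pow K θ' h1 hmul d m (fun i _ => hdpow i)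
  have hinv : ∀ j, (c ^ j)⁻¹ = d ^ j := fun j => by
    refine inv_eq_of_mul_eq_one_right ?_
    rw [hd, ← pow_mul, ← pow_add, show j + (m - 1) * j = m * j by
      conv_rhs => rw [← Nat.sub_add_cancel hm]
      ring]
    rw [pow_mul, hcm, one_pow]
  refine ⟨?_, ?_⟩
  · rw [List.sum_toFinset _ hnd, List.map_map]
    rw [← List.sum_toFinset _ List.nodup_range, List.toFinset_range]
    refine Finset.sum_congr rfl fun j hj => ?_
    have hj' : j < m := Finset.mem_range.mp hj
    simp only [Function.comp_apply]
    rw [hinv j, hθd j hj'.le]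
  · have hdm : d ^ m = 1 := by rw [hd, ← pow_mul, hmod, Nat.mul_mod_left, pow_zero]
    rw [← hθd m le_rfl, hdm, h1]

/-! ### The vanishing mechanism for `K ∋ −1` with `λ'(−1) = 1` -/

/-- Block `0` of the kernel check `χ₁(−g) = −χ₁(g)` (in coordinates). [folklore] -/
private theorem testNeg_b0 : ((elems.drop 0).take 24).all
    (fun g => decide (T4 (z * g) = -T4 g ∧ A2 (z * g) = -A2 g ∧ B2 (z * g) = -B2 g)) = true := by
  decide +kernel
/-- Block `1` of the kernel check `χ₁(−g) = −χ₁(g)`. [folklore] -/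
private theorem testNeg_b1 : ((elems.drop 24).take 24).all
    (fun g => decide (T4 (z * g) = -T4 g ∧ A2 (z * g) = -A2 g ∧ B2 (z * g) = -B2 g)) = true := by
  decide +kernel

/-- `χ₁(−g) = −χ₁(g)`. [cite: Booker2006, §2 p. 390] -/
private theorem chi1_z_mul (g : GL (Fin 2) (ZMod 3)) : chi1 (z * g) = -chi1 g := by
  obtain ⟨h4, hA, hB⟩ := of_decide_eq_true (forall_of_blocks
    (fun g => decide (T4 (z * g) = -T4 g ∧ A2 (z * g) = -A2 g ∧ B2 (z * g) = -B2 g))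
    testNeg_b0 testNeg_b1 g)
  simp only [chi1, chi4, chi2, toC, h4, hA, hB, map_neg, Int.cast_neg]
  ring

/-- `(−1)² = 1`. [folklore] -/
private theorem z_mul_z : z * z = 1 := by decide

/-- **If `−1 ∈ K`, `K` is stable under `k ↦ −k` and inversion, and `λ'(−1) = 1`, then
`Σ_{k ∈ K} χ₁(k) λ'(k⁻¹) = 0`.** [cite: Booker2006, §2 p. 390] -/
private theorem sum_eq_zero_of_central (K : List (GL (Fin 2) (ZMod 3))) (hz : z ∈ K)
    (hzK : ∀ k ∈ K, z * k ∈ K) (hinvK : ∀ k ∈ K, k⁻¹ ∈ K) (θ' : GL (Fin 2) (ZMod 3) → ℂ)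
    (hmul : ∀ a ∈ K, ∀ b ∈ K, θ' (a * b) = θ' a * θ' b) (hθz : θ' z = 1) :
    ∑ k ∈ K.toFinset, chi1 k * θ' k⁻¹ = 0 := by
  set S := K.toFinset
  have hS : ∀ k ∈ S, z * k ∈ S := fun k hk =>
    List.mem_toFinset.mpr (hzK k (List.mem_toFinset.mp hk))
  have h1 : ∑ k ∈ S, chi1 k * θ' k⁻¹ = ∑ k ∈ S, chi1 (z * k) * θ' (z * k)⁻¹ := by
    refine (Finset.sum_bij' (fun k _ => z * k) (fun k _ => z * k) hS hS ?_ ?_ ?_).symm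
    · intro k _; rw [← mul_assoc, z_mul_z, one_mul]
    · intro k _; rw [← mul_assoc, z_mul_z, one_mul]
    · intro k _; rfl
  have h2 : ∀ k ∈ S, chi1 (z * k) * θ' (z * k)⁻¹ = -(chi1 k * θ' k⁻¹) := by
    intro k hk
    have hk' := List.mem_toFinset.mp hk
    have hzinv : (z * k)⁻¹ = k⁻¹ * z := by
      rw [mul_inv_rev, show z⁻¹ = z from inv_eq_of_mul_eq_one_right z_mul_z]
    rw [hzinv, hmul _ (hinvK k hk') _ hz, hθz, mul_one, chi1_z_mul]
    ring
  have h3 : ∑ k ∈ S, chi1 k * θ' k⁻¹ = -∑ k ∈ S, chi1 k * θ' k⁻¹ :=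
    calc ∑ k ∈ S, chi1 k * θ' k⁻¹ = ∑ k ∈ S, chi1 (z * k) * θ' (z * k)⁻¹ := h1
      _ = ∑ k ∈ S, -(chi1 k * θ' k⁻¹) := Finset.sum_congr rfl h2
      _ = -∑ k ∈ S, chi1 k * θ' k⁻¹ := Finset.sum_neg_distrib _
  have h4 : (2 : ℂ) * ∑ k ∈ S, chi1 k * θ' k⁻¹ = 0 := by linear_combination h3
  simpa using h4

/-- `λ'(−1) = 1` when `−1 = i j i⁻¹ j⁻¹` is a commutator of elements `i, j` with
`i, j, i⁻¹, j⁻¹, ij, iji⁻¹ ∈ K`. [cite: Booker2006, §2 p. 390] -/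
private theorem theta_z_of_comm (K : List (GL (Fin 2) (ZMod 3))) (θ' : GL (Fin 2) (ZMod 3) → ℂ)
    (h1 : θ' 1 = 1) (hmul : ∀ a ∈ K, ∀ b ∈ K, θ' (a * b) = θ' a * θ' b)
    (i j : GL (Fin 2) (ZMod 3)) (hi : i ∈ K) (hj : j ∈ K) (hii : i⁻¹ ∈ K) (hji : j⁻¹ ∈ K)
    (hij : i * j ∈ K) (hiji : i * j * i⁻¹ ∈ K) (hz : i * j * i⁻¹ * j⁻¹ = z) : θ' z = 1 := by
  have hA : θ' i * θ' i⁻¹ = 1 := by rw [← hmul _ hi _ hii, mul_inv_cancel, h1]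
  have hB : θ' j * θ' j⁻¹ = 1 := by rw [← hmul _ hj _ hji, mul_inv_cancel, h1]
  rw [← hz, hmul _ hiji _ hji, hmul _ hij _ hii, hmul _ hi _ hj]
  linear_combination θ' j * θ' j⁻¹ * hA + hB

/-! ### The sixteen representatives -/

/-- `L1 = 1`. [cite: Booker2006, §2 p. 390] -/
private theorem pos_L1 (θ' : GL (Fin 2) (ZMod 3) → ℂ) (h1 : θ' 1 = 1) :
    0 ≤ ∑ k ∈ L1.toFinset, chi1 k * θ' k⁻¹ := by
  have hK : L1 = [1] := by decide
  rw [hK]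
  simp only [List.toFinset_cons, List.toFinset_nil, insert_empty_eq, sum_singleton, inv_one, h1,
    mul_one, chi1_one]
  exact natCast_nonneg' 2

/-- The value of `χ₁` from its coordinates `(T₄, A₂, B₂)`. [folklore] -/
private theorem chi1_of_coords {g : GL (Fin 2) (ZMod 3)} {t : ℤ} {a b : GaussianInt}
    (h : (T4 g, A2 g, B2 g) = (t, a, b)) :
    chi1 g = (t : ℂ) - (GaussianInt.toComplex a + GaussianInt.toComplex b * uC) := by
  simp only [Prod.mk.injEq] at h
  obtain ⟨h1, h2, h3⟩ := h
  simp only [chi1, chi4, chi2, toC, h1, h2, h3]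

/-- The cyclic listing `⟨c⟩`, `c = (1 0 0 2)`, order `2`: `Σ_{j<2} χ₁(cʲ) u'ʲ ≥ 0` for
`u'^2 = 1`. [cite: Booker2006, §2 p. 390] -/
private theorem pos_cyc_L2 (θ' : GL (Fin 2) (ZMod 3) → ℂ) (h1 : θ' 1 = 1)
    (hmul : ∀ a ∈ (List.range 2).map (m 1 0 0 2 ^ ·), ∀ b ∈ (List.range 2).map (m 1 0 0 2 ^ ·),
      θ' (a * b) = θ' a * θ' b) :
    0 ≤ ∑ k ∈ ((List.range 2).map (m 1 0 0 2 ^ ·)).toFinset, chi1 k * θ' k⁻¹ := by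
  obtain ⟨hsum, hu⟩ := cyclic_sum (m 1 0 0 2) 2 (by norm_num) (by decide +kernel) (by decide +kernel) θ' h1 hmul
  rw [hsum]
  have v0 : (T4 (m 1 0 0 2 ^ 0), A2 (m 1 0 0 2 ^ 0), B2 (m 1 0 0 2 ^ 0)) = ((4 : ℤ), (2 : GaussianInt), (0 : GaussianInt)) := by
    decide +kernel
  have v1 : (T4 (m 1 0 0 2 ^ 1), A2 (m 1 0 0 2 ^ 1), B2 (m 1 0 0 2 ^ 1)) = ((0 : ℤ), (0 : GaussianInt), (0 : GaussianInt)) := by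
    decide +kernel
  simp only [Finset.sum_range_succ, Finset.sum_range_zero, zero_add]
  rw [chi1_of_coords v0, chi1_of_coords v1]
  simp only [map_zero, map_ofNat, pow_zero, pow_one, mul_one]
  push_cast
  have := P2a_nonneg (θ' (m 1 0 0 2 ^ (2 - 1))) 
  convert this using 1
  ring

/-- `L2 = ⟨(1 0 0 2)⟩` (order `2`): DM-positivity of `χ₁`. [cite: Booker2006, §2 p. 390] -/
private theorem pos_L2 (θ' : GL (Fin 2) (ZMod 3) → ℂ) (h1 : θ' 1 = 1)
    (hmul : ∀ a ∈ L2, ∀ b ∈ L2, θ' (a * b) = θ' a * θ' b) :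
    0 ≤ ∑ k ∈ L2.toFinset, chi1 k * θ' k⁻¹ := by
  have hK : L2 = (List.range 2).map (m 1 0 0 2 ^ ·) := by decide +kernel
  rw [hK] at hmul ⊢
  exact pos_cyc_L2 θ' h1 hmul

/-- The cyclic listing `⟨c⟩`, `c = (2 0 0 2)`, order `2`: `Σ_{j<2} χ₁(cʲ) u'ʲ ≥ 0` for
`u'^2 = 1`. [cite: Booker2006, §2 p. 390] -/
private theorem pos_cyc_Lz (θ' : GL (Fin 2) (ZMod 3) → ℂ) (h1 : θ' 1 = 1)
    (hmul : ∀ a ∈ (List.range 2).map (m 2 0 0 2 ^ ·), ∀ b ∈ (List.range 2).map (m 2 0 0 2 ^ ·),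
      θ' (a * b) = θ' a * θ' b) :
    0 ≤ ∑ k ∈ ((List.range 2).map (m 2 0 0 2 ^ ·)).toFinset, chi1 k * θ' k⁻¹ := by
  obtain ⟨hsum, hu⟩ := cyclic_sum (m 2 0 0 2) 2 (by norm_num) (by decide +kernel) (by decide +kernel) θ' h1 hmul
  rw [hsum]
  have v0 : (T4 (m 2 0 0 2 ^ 0), A2 (m 2 0 0 2 ^ 0), B2 (m 2 0 0 2 ^ 0)) = ((4 : ℤ), (2 : GaussianInt), (0 : GaussianInt)) := by
    decide +kernel
  have v1 : (T4 (m 2 0 0 2 ^ 1), A2 (m 2 0 0 2 ^ 1), B2 (m 2 0 0 2 ^ 1)) = ((-4 : ℤ), (-2 : GaussianInt), (0 : GaussianInt)) := by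
    decide +kernel
  simp only [Finset.sum_range_succ, Finset.sum_range_zero, zero_add]
  rw [chi1_of_coords v0, chi1_of_coords v1]
  simp only [map_zero, map_neg, map_ofNat, pow_zero, pow_one, mul_one]
  push_cast
  have := P2_nonneg (θ' (m 2 0 0 2 ^ (2 - 1))) hu
  convert this using 1
  ring

/-- `Lz = ⟨(2 0 0 2)⟩` (order `2`): DM-positivity of `χ₁`. [cite: Booker2006, §2 p. 390] -/
private theorem pos_Lz (θ' : GL (Fin 2) (ZMod 3) → ℂ) (h1 : θ' 1 = 1)
    (hmul : ∀ a ∈ Lz, ∀ b ∈ Lz, θ' (a * b) = θ' a * θ' b) :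
    0 ≤ ∑ k ∈ Lz.toFinset, chi1 k * θ' k⁻¹ := by
  have hK : Lz = (List.range 2).map (m 2 0 0 2 ^ ·) := by decide +kernel
  rw [hK] at hmul ⊢
  exact pos_cyc_Lz θ' h1 hmul

/-- The cyclic listing `⟨c⟩`, `c = (1 1 0 1)`, order `3`: `Σ_{j<3} χ₁(cʲ) u'ʲ ≥ 0` for
`u'^3 = 1`. [cite: Booker2006, §2 p. 390] -/
private theorem pos_cyc_L3 (θ' : GL (Fin 2) (ZMod 3) → ℂ) (h1 : θ' 1 = 1)
    (hmul : ∀ a ∈ (List.range 3).map (m 1 1 0 1 ^ ·), ∀ b ∈ (List.range 3).map (m 1 1 0 1 ^ ·),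
      θ' (a * b) = θ' a * θ' b) :
    0 ≤ ∑ k ∈ ((List.range 3).map (m 1 1 0 1 ^ ·)).toFinset, chi1 k * θ' k⁻¹ := by
  obtain ⟨hsum, hu⟩ := cyclic_sum (m 1 1 0 1) 3 (by norm_num) (by decide +kernel) (by decide +kernel) θ' h1 hmul
  rw [hsum]
  have v0 : (T4 (m 1 1 0 1 ^ 0), A2 (m 1 1 0 1 ^ 0), B2 (m 1 1 0 1 ^ 0)) = ((4 : ℤ), (2 : GaussianInt), (0 : GaussianInt)) := by
    decide +kernel
  have v1 : (T4 (m 1 1 0 1 ^ 1), A2 (m 1 1 0 1 ^ 1), B2 (m 1 1 0 1 ^ 1)) = ((1 : ℤ), (-1 : GaussianInt), (0 : GaussianInt)) := by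
    decide +kernel
  have v2 : (T4 (m 1 1 0 1 ^ 2), A2 (m 1 1 0 1 ^ 2), B2 (m 1 1 0 1 ^ 2)) = ((1 : ℤ), (-1 : GaussianInt), (0 : GaussianInt)) := by
    decide +kernel
  simp only [Finset.sum_range_succ, Finset.sum_range_zero, zero_add]
  rw [chi1_of_coords v0, chi1_of_coords v1, chi1_of_coords v2]
  simp only [map_zero, map_one, map_neg, map_ofNat, pow_zero, pow_one, mul_one]
  push_cast
  have := P3_nonneg (θ' (m 1 1 0 1 ^ (3 - 1))) hu
  convert this using 1
  ring

/-- `L3 = ⟨(1 1 0 1)⟩` (order `3`): DM-positivity of `χ₁`. [cite: Booker2006, §2 p. 390] -/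
private theorem pos_L3 (θ' : GL (Fin 2) (ZMod 3) → ℂ) (h1 : θ' 1 = 1)
    (hmul : ∀ a ∈ L3, ∀ b ∈ L3, θ' (a * b) = θ' a * θ' b) :
    0 ≤ ∑ k ∈ L3.toFinset, chi1 k * θ' k⁻¹ := by
  have hK : L3 = (List.range 3).map (m 1 1 0 1 ^ ·) := by decide +kernel
  rw [hK] at hmul ⊢
  exact pos_cyc_L3 θ' h1 hmul

/-- The cyclic listing `⟨c⟩`, `c = (0 1 2 0)`, order `4`: `Σ_{j<4} χ₁(cʲ) u'ʲ ≥ 0` for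
`u'^4 = 1`. [cite: Booker2006, §2 p. 390] -/
private theorem pos_cyc_L4 (θ' : GL (Fin 2) (ZMod 3) → ℂ) (h1 : θ' 1 = 1)
    (hmul : ∀ a ∈ (List.range 4).map (m 0 1 2 0 ^ ·), ∀ b ∈ (List.range 4).map (m 0 1 2 0 ^ ·),
      θ' (a * b) = θ' a * θ' b) :
    0 ≤ ∑ k ∈ ((List.range 4).map (m 0 1 2 0 ^ ·)).toFinset, chi1 k * θ' k⁻¹ := by
  obtain ⟨hsum, hu⟩ := cyclic_sum (m 0 1 2 0) 4 (by norm_num) (by decide +kernel) (by decide +kernel) θ' h1 hmul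
  rw [hsum]
  have v0 : (T4 (m 0 1 2 0 ^ 0), A2 (m 0 1 2 0 ^ 0), B2 (m 0 1 2 0 ^ 0)) = ((4 : ℤ), (2 : GaussianInt), (0 : GaussianInt)) := by
    decide +kernel
  have v1 : (T4 (m 0 1 2 0 ^ 1), A2 (m 0 1 2 0 ^ 1), B2 (m 0 1 2 0 ^ 1)) = ((0 : ℤ), (0 : GaussianInt), (0 : GaussianInt)) := by
    decide +kernel
  have v2 : (T4 (m 0 1 2 0 ^ 2), A2 (m 0 1 2 0 ^ 2), B2 (m 0 1 2 0 ^ 2)) = ((-4 : ℤ), (-2 : GaussianInt), (0 : GaussianInt)) := by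
    decide +kernel
  have v3 : (T4 (m 0 1 2 0 ^ 3), A2 (m 0 1 2 0 ^ 3), B2 (m 0 1 2 0 ^ 3)) = ((0 : ℤ), (0 : GaussianInt), (0 : GaussianInt)) := by
    decide +kernel
  simp only [Finset.sum_range_succ, Finset.sum_range_zero, zero_add]
  rw [chi1_of_coords v0, chi1_of_coords v1, chi1_of_coords v2, chi1_of_coords v3]
  simp only [map_zero, map_neg, map_ofNat, pow_zero, pow_one, mul_one]
  push_cast
  have := P4_nonneg (θ' (m 0 1 2 0 ^ (4 - 1))) hu
  convert this using 1
  ring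

/-- `L4 = ⟨(0 1 2 0)⟩` (order `4`): DM-positivity of `χ₁`. [cite: Booker2006, §2 p. 390] -/
private theorem pos_L4 (θ' : GL (Fin 2) (ZMod 3) → ℂ) (h1 : θ' 1 = 1)
    (hmul : ∀ a ∈ L4, ∀ b ∈ L4, θ' (a * b) = θ' a * θ' b) :
    0 ≤ ∑ k ∈ L4.toFinset, chi1 k * θ' k⁻¹ := by
  have hK : L4 = (List.range 4).map (m 0 1 2 0 ^ ·) := by decide +kernel
  rw [hK] at hmul ⊢
  exact pos_cyc_L4 θ' h1 hmul

/-- The cyclic listing `⟨c⟩`, `c = (2 2 0 2)`, order `6`: `Σ_{j<6} χ₁(cʲ) u'ʲ ≥ 0` for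
`u'^6 = 1`. [cite: Booker2006, §2 p. 390] -/
private theorem pos_cyc_L6 (θ' : GL (Fin 2) (ZMod 3) → ℂ) (h1 : θ' 1 = 1)
    (hmul : ∀ a ∈ (List.range 6).map (m 2 2 0 2 ^ ·), ∀ b ∈ (List.range 6).map (m 2 2 0 2 ^ ·),
      θ' (a * b) = θ' a * θ' b) :
    0 ≤ ∑ k ∈ ((List.range 6).map (m 2 2 0 2 ^ ·)).toFinset, chi1 k * θ' k⁻¹ := by
  obtain ⟨hsum, hu⟩ := cyclic_sum (m 2 2 0 2) 6 (by norm_num) (by decide +kernel) (by decide +kernel) θ' h1 hmul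
  rw [hsum]
  have v0 : (T4 (m 2 2 0 2 ^ 0), A2 (m 2 2 0 2 ^ 0), B2 (m 2 2 0 2 ^ 0)) = ((4 : ℤ), (2 : GaussianInt), (0 : GaussianInt)) := by
    decide +kernel
  have v1 : (T4 (m 2 2 0 2 ^ 1), A2 (m 2 2 0 2 ^ 1), B2 (m 2 2 0 2 ^ 1)) = ((-1 : ℤ), (1 : GaussianInt), (0 : GaussianInt)) := by
    decide +kernel
  have v2 : (T4 (m 2 2 0 2 ^ 2), A2 (m 2 2 0 2 ^ 2), B2 (m 2 2 0 2 ^ 2)) = ((1 : ℤ), (-1 : GaussianInt), (0 : GaussianInt)) := by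
    decide +kernel
  have v3 : (T4 (m 2 2 0 2 ^ 3), A2 (m 2 2 0 2 ^ 3), B2 (m 2 2 0 2 ^ 3)) = ((-4 : ℤ), (-2 : GaussianInt), (0 : GaussianInt)) := by
    decide +kernel
  have v4 : (T4 (m 2 2 0 2 ^ 4), A2 (m 2 2 0 2 ^ 4), B2 (m 2 2 0 2 ^ 4)) = ((1 : ℤ), (-1 : GaussianInt), (0 : GaussianInt)) := by
    decide +kernel
  have v5 : (T4 (m 2 2 0 2 ^ 5), A2 (m 2 2 0 2 ^ 5), B2 (m 2 2 0 2 ^ 5)) = ((-1 : ℤ), (1 : GaussianInt), (0 : GaussianInt)) := by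
    decide +kernel
  simp only [Finset.sum_range_succ, Finset.sum_range_zero, zero_add]
  rw [chi1_of_coords v0, chi1_of_coords v1, chi1_of_coords v2, chi1_of_coords v3, chi1_of_coords v4, chi1_of_coords v5]
  simp only [map_zero, map_one, map_neg, map_ofNat, pow_zero, pow_one, mul_one]
  push_cast
  have := P6_nonneg (θ' (m 2 2 0 2 ^ (6 - 1))) hu
  convert this using 1
  ring

/-- `L6 = ⟨(2 2 0 2)⟩` (order `6`): DM-positivity of `χ₁`. [cite: Booker2006, §2 p. 390] -/
private theorem pos_L6 (θ' : GL (Fin 2) (ZMod 3) → ℂ) (h1 : θ' 1 = 1)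
    (hmul : ∀ a ∈ L6, ∀ b ∈ L6, θ' (a * b) = θ' a * θ' b) :
    0 ≤ ∑ k ∈ L6.toFinset, chi1 k * θ' k⁻¹ := by
  have hK : L6 = (List.range 6).map (m 2 2 0 2 ^ ·) := by decide +kernel
  rw [hK] at hmul ⊢
  exact pos_cyc_L6 θ' h1 hmul

/-- The cyclic listing `⟨c⟩`, `c = (0 1 1 1)`, order `8`: `Σ_{j<8} χ₁(cʲ) u'ʲ ≥ 0` for
`u'^8 = 1`. [cite: Booker2006, §2 p. 390] -/
private theorem pos_cyc_L8 (θ' : GL (Fin 2) (ZMod 3) → ℂ) (h1 : θ' 1 = 1)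
    (hmul : ∀ a ∈ (List.range 8).map (m 0 1 1 1 ^ ·), ∀ b ∈ (List.range 8).map (m 0 1 1 1 ^ ·),
      θ' (a * b) = θ' a * θ' b) :
    0 ≤ ∑ k ∈ ((List.range 8).map (m 0 1 1 1 ^ ·)).toFinset, chi1 k * θ' k⁻¹ := by
  obtain ⟨hsum, hu⟩ := cyclic_sum (m 0 1 1 1) 8 (by norm_num) (by decide +kernel) (by decide +kernel) θ' h1 hmul
  rw [hsum]
  have v0 : (T4 (m 0 1 1 1 ^ 0), A2 (m 0 1 1 1 ^ 0), B2 (m 0 1 1 1 ^ 0)) = ((4 : ℤ), (2 : GaussianInt), (0 : GaussianInt)) := by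
    decide +kernel
  have v1 : (T4 (m 0 1 1 1 ^ 1), A2 (m 0 1 1 1 ^ 1), B2 (m 0 1 1 1 ^ 1)) = ((0 : ℤ), (0 : GaussianInt), (⟨1, 1⟩ : GaussianInt)) := by
    decide +kernel
  have v2 : (T4 (m 0 1 1 1 ^ 2), A2 (m 0 1 1 1 ^ 2), B2 (m 0 1 1 1 ^ 2)) = ((0 : ℤ), (0 : GaussianInt), (0 : GaussianInt)) := by
    decide +kernel
  have v3 : (T4 (m 0 1 1 1 ^ 3), A2 (m 0 1 1 1 ^ 3), B2 (m 0 1 1 1 ^ 3)) = ((0 : ℤ), (0 : GaussianInt), (⟨1, 1⟩ : GaussianInt)) := by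
    decide +kernel
  have v4 : (T4 (m 0 1 1 1 ^ 4), A2 (m 0 1 1 1 ^ 4), B2 (m 0 1 1 1 ^ 4)) = ((-4 : ℤ), (-2 : GaussianInt), (0 : GaussianInt)) := by
    decide +kernel
  have v5 : (T4 (m 0 1 1 1 ^ 5), A2 (m 0 1 1 1 ^ 5), B2 (m 0 1 1 1 ^ 5)) = ((0 : ℤ), (0 : GaussianInt), (⟨-1, -1⟩ : GaussianInt)) := by
    decide +kernel
  have v6 : (T4 (m 0 1 1 1 ^ 6), A2 (m 0 1 1 1 ^ 6), B2 (m 0 1 1 1 ^ 6)) = ((0 : ℤ), (0 : GaussianInt), (0 : GaussianInt)) := by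
    decide +kernel
  have v7 : (T4 (m 0 1 1 1 ^ 7), A2 (m 0 1 1 1 ^ 7), B2 (m 0 1 1 1 ^ 7)) = ((0 : ℤ), (0 : GaussianInt), (⟨-1, -1⟩ : GaussianInt)) := by
    decide +kernel
  simp only [Finset.sum_range_succ, Finset.sum_range_zero, zero_add]
  rw [chi1_of_coords v0, chi1_of_coords v1, chi1_of_coords v2, chi1_of_coords v3, chi1_of_coords v4, chi1_of_coords v5, chi1_of_coords v6, chi1_of_coords v7]
  simp only [map_zero, map_neg, map_ofNat, GaussianInt.toComplex_def', pow_zero, pow_one, mul_one]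
  push_cast
  have := P8_nonneg (θ' (m 0 1 1 1 ^ (8 - 1))) hu
  convert this using 1
  ring

/-- `L8 = ⟨(0 1 1 1)⟩` (order `8`): DM-positivity of `χ₁`. [cite: Booker2006, §2 p. 390] -/
private theorem pos_L8 (θ' : GL (Fin 2) (ZMod 3) → ℂ) (h1 : θ' 1 = 1)
    (hmul : ∀ a ∈ L8, ∀ b ∈ L8, θ' (a * b) = θ' a * θ' b) :
    0 ≤ ∑ k ∈ L8.toFinset, chi1 k * θ' k⁻¹ := by
  have hK : L8 = (List.range 8).map (m 0 1 1 1 ^ ·) := by decide +kernel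
  rw [hK] at hmul ⊢
  exact pos_cyc_L8 θ' h1 hmul

/-- `Lv = ⟨a⟩ ++ ⟨a⟩x` (order `4`): `χ₁` vanishes on the coset `⟨a⟩x` (reflections) and the
`⟨a⟩`-part is the cyclic case of order `2`. [cite: Booker2006, §2 p. 390] -/
private theorem pos_Lv (θ' : GL (Fin 2) (ZMod 3) → ℂ) (h1 : θ' 1 = 1)
    (hmul : ∀ a ∈ Lv, ∀ b ∈ Lv, θ' (a * b) = θ' a * θ' b) :
    0 ≤ ∑ k ∈ Lv.toFinset, chi1 k * θ' k⁻¹ := by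
  have hK : Lv = (List.range 2).map (m 2 0 0 2 ^ ·) ++ Lv.drop 2 := by decide +kernel
  have hsub : ∀ a ∈ (List.range 2).map (m 2 0 0 2 ^ ·), a ∈ Lv := fun a ha => by
    rw [hK]; exact List.mem_append_left _ ha
  have hzero : ∀ k ∈ Lv.drop 2, (T4 k, A2 k, B2 k) = (0, 0, 0) := by decide +kernel
  have hdisj : Disjoint ((List.range 2).map (m 2 0 0 2 ^ ·)).toFinset (Lv.drop 2).toFinset := by
    rw [Finset.disjoint_left]
    intro a ha hb
    have h' : ∀ x ∈ (List.range 2).map (m 2 0 0 2 ^ ·), x ∉ Lv.drop 2 := by decide +kernel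
    exact h' a (List.mem_toFinset.mp ha) (List.mem_toFinset.mp hb)
  have hmul' : ∀ a ∈ (List.range 2).map (m 2 0 0 2 ^ ·), ∀ b ∈ (List.range 2).map (m 2 0 0 2 ^ ·),
      θ' (a * b) = θ' a * θ' b := fun a ha b hb => hmul a (hsub a ha) b (hsub b hb)
  rw [hK, List.toFinset_append, Finset.sum_union hdisj]
  have h0 : ∑ k ∈ (Lv.drop 2).toFinset, chi1 k * θ' k⁻¹ = 0 :=
    Finset.sum_eq_zero fun k hk => by
      rw [chi1_of_coords (hzero k (List.mem_toFinset.mp hk))]; simp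
  rw [h0, add_zero]
  exact pos_cyc_Lz θ' h1 hmul'

/-- `L6a = ⟨a⟩ ++ ⟨a⟩x` (order `6`): `χ₁` vanishes on the coset `⟨a⟩x` (reflections) and the
`⟨a⟩`-part is the cyclic case of order `3`. [cite: Booker2006, §2 p. 390] -/
private theorem pos_L6a (θ' : GL (Fin 2) (ZMod 3) → ℂ) (h1 : θ' 1 = 1)
    (hmul : ∀ a ∈ L6a, ∀ b ∈ L6a, θ' (a * b) = θ' a * θ' b) :
    0 ≤ ∑ k ∈ L6a.toFinset, chi1 k * θ' k⁻¹ := by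
  have hK : L6a = (List.range 3).map (m 1 1 0 1 ^ ·) ++ L6a.drop 3 := by decide +kernel
  have hsub : ∀ a ∈ (List.range 3).map (m 1 1 0 1 ^ ·), a ∈ L6a := fun a ha => by
    rw [hK]; exact List.mem_append_left _ ha
  have hzero : ∀ k ∈ L6a.drop 3, (T4 k, A2 k, B2 k) = (0, 0, 0) := by decide +kernel
  have hdisj : Disjoint ((List.range 3).map (m 1 1 0 1 ^ ·)).toFinset (L6a.drop 3).toFinset := by
    rw [Finset.disjoint_left]
    intro a ha hb
    have h' : ∀ x ∈ (List.range 3).map (m 1 1 0 1 ^ ·), x ∉ L6a.drop 3 := by decide +kernel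
    exact h' a (List.mem_toFinset.mp ha) (List.mem_toFinset.mp hb)
  have hmul' : ∀ a ∈ (List.range 3).map (m 1 1 0 1 ^ ·), ∀ b ∈ (List.range 3).map (m 1 1 0 1 ^ ·),
      θ' (a * b) = θ' a * θ' b := fun a ha b hb => hmul a (hsub a ha) b (hsub b hb)
  rw [hK, List.toFinset_append, Finset.sum_union hdisj]
  have h0 : ∑ k ∈ (L6a.drop 3).toFinset, chi1 k * θ' k⁻¹ = 0 :=
    Finset.sum_eq_zero fun k hk => by
      rw [chi1_of_coords (hzero k (List.mem_toFinset.mp hk))]; simp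
  rw [h0, add_zero]
  exact pos_cyc_L3 θ' h1 hmul'

/-- `L6b = ⟨a⟩ ++ ⟨a⟩x` (order `6`): `χ₁` vanishes on the coset `⟨a⟩x` (reflections) and the
`⟨a⟩`-part is the cyclic case of order `3`. [cite: Booker2006, §2 p. 390] -/
private theorem pos_L6b (θ' : GL (Fin 2) (ZMod 3) → ℂ) (h1 : θ' 1 = 1)
    (hmul : ∀ a ∈ L6b, ∀ b ∈ L6b, θ' (a * b) = θ' a * θ' b) :
    0 ≤ ∑ k ∈ L6b.toFinset, chi1 k * θ' k⁻¹ := by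
  have hK : L6b = (List.range 3).map (m 1 1 0 1 ^ ·) ++ L6b.drop 3 := by decide +kernel
  have hsub : ∀ a ∈ (List.range 3).map (m 1 1 0 1 ^ ·), a ∈ L6b := fun a ha => by
    rw [hK]; exact List.mem_append_left _ ha
  have hzero : ∀ k ∈ L6b.drop 3, (T4 k, A2 k, B2 k) = (0, 0, 0) := by decide +kernel
  have hdisj : Disjoint ((List.range 3).map (m 1 1 0 1 ^ ·)).toFinset (L6b.drop 3).toFinset := by
    rw [Finset.disjoint_left]
    intro a ha hb
    have h' : ∀ x ∈ (List.range 3).map (m 1 1 0 1 ^ ·), x ∉ L6b.drop 3 := by decide +kernel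
    exact h' a (List.mem_toFinset.mp ha) (List.mem_toFinset.mp hb)
  have hmul' : ∀ a ∈ (List.range 3).map (m 1 1 0 1 ^ ·), ∀ b ∈ (List.range 3).map (m 1 1 0 1 ^ ·),
      θ' (a * b) = θ' a * θ' b := fun a ha b hb => hmul a (hsub a ha) b (hsub b hb)
  rw [hK, List.toFinset_append, Finset.sum_union hdisj]
  have h0 : ∑ k ∈ (L6b.drop 3).toFinset, chi1 k * θ' k⁻¹ = 0 :=
    Finset.sum_eq_zero fun k hk => by
      rw [chi1_of_coords (hzero k (List.mem_toFinset.mp hk))]; simp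
  rw [h0, add_zero]
  exact pos_cyc_L3 θ' h1 hmul'

/-- `L12 = ⟨a⟩ ++ ⟨a⟩x` (order `12`): `χ₁` vanishes on the coset `⟨a⟩x` (reflections) and the
`⟨a⟩`-part is the cyclic case of order `6`. [cite: Booker2006, §2 p. 390] -/
private theorem pos_L12 (θ' : GL (Fin 2) (ZMod 3) → ℂ) (h1 : θ' 1 = 1)
    (hmul : ∀ a ∈ L12, ∀ b ∈ L12, θ' (a * b) = θ' a * θ' b) :
    0 ≤ ∑ k ∈ L12.toFinset, chi1 k * θ' k⁻¹ := by
  have hK : L12 = (List.range 6).map (m 2 2 0 2 ^ ·) ++ L12.drop 6 := by decide +kernel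
  have hsub : ∀ a ∈ (List.range 6).map (m 2 2 0 2 ^ ·), a ∈ L12 := fun a ha => by
    rw [hK]; exact List.mem_append_left _ ha
  have hzero : ∀ k ∈ L12.drop 6, (T4 k, A2 k, B2 k) = (0, 0, 0) := by decide +kernel
  have hdisj : Disjoint ((List.range 6).map (m 2 2 0 2 ^ ·)).toFinset (L12.drop 6).toFinset := by
    rw [Finset.disjoint_left]
    intro a ha hb
    have h' : ∀ x ∈ (List.range 6).map (m 2 2 0 2 ^ ·), x ∉ L12.drop 6 := by decide +kernel
    exact h' a (List.mem_toFinset.mp ha) (List.mem_toFinset.mp hb)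
  have hmul' : ∀ a ∈ (List.range 6).map (m 2 2 0 2 ^ ·), ∀ b ∈ (List.range 6).map (m 2 2 0 2 ^ ·),
      θ' (a * b) = θ' a * θ' b := fun a ha b hb => hmul a (hsub a ha) b (hsub b hb)
  rw [hK, List.toFinset_append, Finset.sum_union hdisj]
  have h0 : ∑ k ∈ (L12.drop 6).toFinset, chi1 k * θ' k⁻¹ = 0 :=
    Finset.sum_eq_zero fun k hk => by
      rw [chi1_of_coords (hzero k (List.mem_toFinset.mp hk))]; simp
  rw [h0, add_zero]
  exact pos_cyc_L6 θ' h1 hmul'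

/-- `Lq`: `−1 = [i, j]` with `i = (0 1 2 0)`, `j = (2 1 1 1)` inside; the sum vanishes.
[cite: Booker2006, §2 p. 390] -/
private theorem pos_Lq (θ' : GL (Fin 2) (ZMod 3) → ℂ) (h1 : θ' 1 = 1)
    (hmul : ∀ a ∈ Lq, ∀ b ∈ Lq, θ' (a * b) = θ' a * θ' b) :
    0 ≤ ∑ k ∈ Lq.toFinset, chi1 k * θ' k⁻¹ := by
  rw [sum_eq_zero_of_central Lq (by decide) (by decide +kernel) (by decide +kernel) θ' hmul
    (theta_z_of_comm Lq θ' h1 hmul (m 0 1 2 0) (m 2 1 1 1) (by decide) (by decide) (by decide +kernel)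
      (by decide +kernel) (by decide +kernel) (by decide +kernel) (by decide +kernel))]

/-- `Ld`: `−1 = [i, j]` with `i = (0 1 1 0)`, `j = (0 1 2 0)` inside; the sum vanishes.
[cite: Booker2006, §2 p. 390] -/
private theorem pos_Ld (θ' : GL (Fin 2) (ZMod 3) → ℂ) (h1 : θ' 1 = 1)
    (hmul : ∀ a ∈ Ld, ∀ b ∈ Ld, θ' (a * b) = θ' a * θ' b) :
    0 ≤ ∑ k ∈ Ld.toFinset, chi1 k * θ' k⁻¹ := by
  rw [sum_eq_zero_of_central Ld (by decide) (by decide +kernel) (by decide +kernel) θ' hmul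
    (theta_z_of_comm Ld θ' h1 hmul (m 0 1 1 0) (m 0 1 2 0) (by decide) (by decide) (by decide +kernel)
      (by decide +kernel) (by decide +kernel) (by decide +kernel) (by decide +kernel))]

/-- `L16`: `−1 = [i, j]` with `i = (2 0 2 1)`, `j = (2 2 0 1)` inside; the sum vanishes.
[cite: Booker2006, §2 p. 390] -/
private theorem pos_L16 (θ' : GL (Fin 2) (ZMod 3) → ℂ) (h1 : θ' 1 = 1)
    (hmul : ∀ a ∈ L16, ∀ b ∈ L16, θ' (a * b) = θ' a * θ' b) :
    0 ≤ ∑ k ∈ L16.toFinset, chi1 k * θ' k⁻¹ := by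
  rw [sum_eq_zero_of_central L16 (by decide) (by decide +kernel) (by decide +kernel) θ' hmul
    (theta_z_of_comm L16 θ' h1 hmul (m 2 0 2 1) (m 2 2 0 1) (by decide) (by decide) (by decide +kernel)
      (by decide +kernel) (by decide +kernel) (by decide +kernel) (by decide +kernel))]

/-- `L24`: `−1 = [i, j]` with `i = (0 1 2 0)`, `j = (1 1 1 2)` inside; the sum vanishes.
[cite: Booker2006, §2 p. 390] -/
private theorem pos_L24 (θ' : GL (Fin 2) (ZMod 3) → ℂ) (h1 : θ' 1 = 1)
    (hmul : ∀ a ∈ L24, ∀ b ∈ L24, θ' (a * b) = θ' a * θ' b) :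
    0 ≤ ∑ k ∈ L24.toFinset, chi1 k * θ' k⁻¹ := by
  rw [sum_eq_zero_of_central L24 (by decide) (by decide +kernel) (by decide +kernel) θ' hmul
    (theta_z_of_comm L24 θ' h1 hmul (m 0 1 2 0) (m 1 1 1 2) (by decide) (by decide) (by decide +kernel)
      (by decide +kernel) (by decide +kernel) (by decide +kernel) (by decide +kernel))]

/-- `L48`: `−1 = [i, j]` with `i = (0 1 1 0)`, `j = (0 1 2 0)` inside; the sum vanishes.
[cite: Booker2006, §2 p. 390] -/
private theorem pos_L48 (θ' : GL (Fin 2) (ZMod 3) → ℂ) (h1 : θ' 1 = 1)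
    (hmul : ∀ a ∈ L48, ∀ b ∈ L48, θ' (a * b) = θ' a * θ' b) :
    0 ≤ ∑ k ∈ L48.toFinset, chi1 k * θ' k⁻¹ := by
  rw [sum_eq_zero_of_central L48 (by decide) (by decide +kernel) (by decide +kernel) θ' hmul
    (theta_z_of_comm L48 θ' h1 hmul (m 0 1 1 0) (m 0 1 2 0) (by decide) (by decide) (by decide +kernel)
      (by decide +kernel) (by decide +kernel) (by decide +kernel) (by decide +kernel))]

/-! ### DM-positivity of `χ₁` and the conclusion -/

/-- **`χ₁ = χ₄ − χ₂` is DM-positive** (stated for `g ↦ χ₄ g − χ₂ g`, which is `χ₁` by definition):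
`⟨χ₁, Ind_H^G λ⟩ ≥ 0` for every subgroup `H ≤ GL(2,3)` and every
linear character `λ` of `H` (Booker's GAP check over all monomial `σ`; here via the kernel-certified
subgroup table `GL23.exists_conj`). [cite: Booker2006, §2 p. 390] -/
theorem isDMPositive_chi4_sub_chi2 : IsDMPositive (fun g : GL (Fin 2) (ZMod 3) => chi4 g - chi2 g) := by
  show IsDMPositive chi1
  classical
  intro H θ
  have hcl : IsClassFun chi1 := isClassFun_of_mem_virtChars chi1_mem_virtChars
  rw [classInner_indClassFun_right H _ hcl, classInner_apply]
  obtain ⟨K, hK, y, hH⟩ := GL23.exists_conj H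
  set Θ : GL (Fin 2) (ZMod 3) → ℂ := fun x => if hx : x ∈ H then ((θ ⟨x, hx⟩ : ℂˣ) : ℂ) else 0 with hΘ
  set θ' : GL (Fin 2) (ZMod 3) → ℂ := fun k => Θ (y * k * y⁻¹) with hθ'
  have hΘH : ∀ x : H, ((θ x : ℂˣ) : ℂ) = Θ x := fun x => by
    simp only [hΘ, SetLike.coe_mem, dif_pos, Subtype.coe_eta]
  have hyK : ∀ k ∈ K, y * k * y⁻¹ ∈ H := fun k hk => (hH _).mpr ⟨k, hk, rfl⟩
  have h1 : θ' 1 = 1 := by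
    have e : y * 1 * y⁻¹ = 1 := by group
    simp only [hθ', hΘ, e, dif_pos H.one_mem]
    rw [show (⟨1, H.one_mem⟩ : H) = 1 from rfl, map_one, Units.val_one]
  have hmul : ∀ a ∈ K, ∀ b ∈ K, θ' (a * b) = θ' a * θ' b := by
    intro a ha b hb
    have e : y * (a * b) * y⁻¹ = (y * a * y⁻¹) * (y * b * y⁻¹) := by group
    simp only [hθ', hΘ, e, dif_pos (hyK a ha), dif_pos (hyK b hb),
      dif_pos (H.mul_mem (hyK a ha) (hyK b hb))]
    rw [← Units.val_mul, ← map_mul]; rfl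
  have hsum : ∑ x : H, chi1 (x : GL (Fin 2) (ZMod 3)) * ((θ x⁻¹ : ℂˣ) : ℂ) =
      ∑ k ∈ K.toFinset, chi1 k * θ' k⁻¹ := by
    have step1 : ∑ x : H, chi1 (x : GL (Fin 2) (ZMod 3)) * ((θ x⁻¹ : ℂˣ) : ℂ) =
        ∑ x : H, (fun g : GL (Fin 2) (ZMod 3) => chi1 g * Θ g⁻¹) x := by
      refine Finset.sum_congr rfl fun x _ => ?_
      simp only [hΘH x⁻¹, Subgroup.coe_inv]
    rw [step1]
    have key := sum_subgroup_eq_sum_carrier H K y hH (fun g => chi1 g * Θ g⁻¹)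
    have rhs : ∑ k ∈ K.toFinset, chi1 k * θ' k⁻¹ =
        ∑ k ∈ K.toFinset, (fun g : GL (Fin 2) (ZMod 3) => chi1 g * Θ g⁻¹) (y * k * y⁻¹) := by
      refine Finset.sum_congr rfl fun k _ => ?_
      have e : (y * k * y⁻¹)⁻¹ = y * k⁻¹ * y⁻¹ := by group
      simp only [hθ', e, hcl k y]
    rw [rhs]
    convert key using 1
  rw [hsum]
  have hcard : (0 : ℂ) ≤ (Fintype.card H : ℂ)⁻¹ := by
    rw [← Complex.ofReal_natCast, ← Complex.ofReal_inv]
    exact Complex.zero_le_real.mpr (inv_nonneg.mpr (Nat.cast_nonneg _))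
  refine mul_nonneg hcard ?_
  simp only [List.mem_cons, List.mem_nil_iff, or_false] at hK
  rcases hK with rfl | rfl | rfl | rfl | rfl | rfl | rfl | rfl | rfl | rfl | rfl | rfl | rfl | rfl |
    rfl | rfl
  · exact pos_L1 θ' h1
  · exact pos_L2 θ' h1 hmul
  · exact pos_Lz θ' h1 hmul
  · exact pos_L3 θ' h1 hmul
  · exact pos_L4 θ' h1 hmul
  · exact pos_Lv θ' h1 hmul
  · exact pos_L6a θ' h1 hmul
  · exact pos_L6b θ' h1 hmul
  · exact pos_L6 θ' h1 hmul
  · exact pos_L8 θ' h1 hmul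
  · exact pos_Lq θ' h1 hmul
  · exact pos_Ld θ' h1 hmul
  · exact pos_L12 θ' h1 hmul
  · exact pos_L16 θ' h1 hmul
  · exact pos_L24 θ' h1 hmul
  · exact pos_L48 θ' h1 hmul

/-- **Booker 2006, §2 p. 390: `GL₂(𝔽₃)` is not almost monomial** — `Tr ρ = χ₄ = (χ₄ − χ₂) + χ₂`
with both summands non-zero DM-positive virtual characters. [cite: Booker2006, §2 p. 390] -/
theorem not_isAlmostMonomial_GL23 : ¬ IsAlmostMonomial (GL (Fin 2) (ZMod 3)) := by
  intro hAM
  have h := hAM chi4 isIrrChar_chi4 chi1 chi1_mem_virtChars chi2 chi2_mem_virtChars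
    isDMPositive_chi4_sub_chi2 (IsCharacter.isDMPositive isIrrChar_chi2.isCharacter) chi4_eq_add
  rcases h with h | h
  · have := congrFun h 1
    rw [chi1_one] at this
    norm_num at this
  · have := congrFun h 1
    rw [chi2_one] at this
    norm_num at this

end GL23

end Booker2006

end Literature.NumberTheory.LFunctions

end
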